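import Mathlib
import Literature.Barriers.ValiantsHypothesis.AlgebraicNaturalProofs
import Literature.Computability.AlgebraicComplexity.ArithCircuitProofs

/-!
# Route BarrierLever — item `PartitionMinorsHitByVP` (stmt-ValiantsHypothesis-19717), part 2/3:
# PRODUCT-STATE witnesses and their partition coefficients

Helper file (`--supports stmt-ValiantsHypothesis-19717`; cell valiant-natproofs, rung V4, 𝒟-side,
prover seat val-np-p3). Definition-free (all gadgets are written out). Closes NO item.

In `MvPolynomial (Fin (h+h)) ℂ` write `x_a = X (castAdd h a)`, `y_c = X (natAdd h c)`. A PRODUCT STATE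
with pairing `π : Fin h ≃ Fin h` and exponent tables `φ a : Bool → Bool → ℕ` at the parameter `T ∈ ℂ` is
`∏_a q_a`, `q_a = Σ_{(e,e') : Bool × Bool} T^{φ a e e'} x_a^e y_{π a}^{e'}`; the WITNESS is a sum
`Σ_{k<m} ∏_a q^{(k)}_a` of `m` product states (own pairing `π k` and tables `φ k` each).

* `coeff_prodState`: `coeff_{x^U y^W} (∏_a q_a) = T ^ (Σ_a φ a [a ∈ U] [π a ∈ W])` (expand the
  product over bit patterns `g : Fin h → Bool × Bool`; exactly the pattern
  `a ↦ ([a ∈ U], [π a ∈ W])` produces the monomial `x^U y^W`).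
* `coeff_sumProdStates`: `coeff_{x^U y^W} (Σ_k ∏_a q^{(k)}_a) = Σ_k T ^ score_k (U, W)`.
* `sumProdStates_mem_smallCircuits`: degree `≤ 2h`, size `≤ 13·h·m + m`, so the witness lies in
  `SmallCircuits ℂ (h+h) (c+2)` whenever `m ≤ (h+h)^c` and `h ≥ 4`.

The exponent vector `Σ_{a∈U} single (castAdd h a) 1 + Σ_{c∈W} single (natAdd h c) 1` is the one of
item 19717's matrix entry, verbatim.

WHAT THIS IS NOT: no determinant is evaluated here (part 3, `…ProductStateSums`); no item is closed.

References: N. Nisan, STOC 1991 (partition matrix); [ForbesShpilkaVolk2018] §8; [Burgisser2000] §2.1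
(size bookkeeping: variables and constants free, one gate per `+`/`×`).
-/

set_option linter.dupNamespace false

namespace Summit.ValiantsHypothesis.ValiantsHypothesis.Theorems.BarrierLever.ProductStateSums

open Finset MvPolynomial

noncomputable section

variable {h : ℕ}

/-! ## 1. Exponent bookkeeping on `Fin (h + h)` -/

/-- `castAdd a ≠ natAdd c` in `Fin (h + h)` (the `x`- and `y`-halves are disjoint). -/
theorem castAdd_ne_natAdd (a c : Fin h) : Fin.castAdd h a ≠ Fin.natAdd h c := by
  intro hac
  have := congrArg Fin.val hac
  simp only [Fin.val_castAdd, Fin.val_natAdd] at this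
  omega

/-- The `x_a`-exponent of the monomial of a bit pattern `g`. -/
theorem patternExpo_apply_castAdd (π : Equiv.Perm (Fin h)) (g : Fin h → Bool × Bool) (a : Fin h) :
    (∑ a', (Finsupp.single (Fin.castAdd h a') (g a').1.toNat +
      Finsupp.single (Fin.natAdd h (π a')) (g a').2.toNat)) (Fin.castAdd h a) = (g a).1.toNat := by
  rw [Finsupp.finsetSum_apply]
  simp only [Finsupp.add_apply, Finsupp.single_apply, Fin.castAdd_inj,
    (castAdd_ne_natAdd _ _).symm, if_false, add_zero]
  rw [Finset.sum_ite_eq' univ a]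
  simp

/-- The `y_c`-exponent of the monomial of a bit pattern `g`. -/
theorem patternExpo_apply_natAdd (π : Equiv.Perm (Fin h)) (g : Fin h → Bool × Bool) (c : Fin h) :
    (∑ a', (Finsupp.single (Fin.castAdd h a') (g a').1.toNat +
      Finsupp.single (Fin.natAdd h (π a')) (g a').2.toNat)) (Fin.natAdd h c) =
      (g (π.symm c)).2.toNat := by
  rw [Finsupp.finsetSum_apply]
  simp only [Finsupp.add_apply, Finsupp.single_apply, Fin.natAdd_inj, castAdd_ne_natAdd,
    if_false, zero_add]
  have key : ∀ a', (π a' = c) = (a' = π.symm c) := fun a' => by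
    rw [Equiv.apply_eq_iff_eq_symm_apply]
  simp only [key]
  rw [Finset.sum_ite_eq' univ (π.symm c)]
  simp

/-- The `x_a`-exponent of the partition monomial `x^U y^W`. -/
theorem partitionExpo_apply_castAdd (U W : Finset (Fin h)) (a : Fin h) :
    ((∑ a' ∈ U, Finsupp.single (Fin.castAdd h a') 1 +
      ∑ c ∈ W, Finsupp.single (Fin.natAdd h c) 1 : Fin (h + h) →₀ ℕ) : Fin (h + h) → ℕ)
      (Fin.castAdd h a) = if a ∈ U then 1 else 0 := by
  rw [Finsupp.add_apply, Finsupp.finsetSum_apply, Finsupp.finsetSum_apply]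
  simp only [Finsupp.single_apply, Fin.castAdd_inj, (castAdd_ne_natAdd _ _).symm, if_false,
    Finset.sum_const_zero, add_zero]
  rw [Finset.sum_ite_eq' U a]

/-- The `y_c`-exponent of the partition monomial `x^U y^W`. -/
theorem partitionExpo_apply_natAdd (U W : Finset (Fin h)) (c : Fin h) :
    ((∑ a' ∈ U, Finsupp.single (Fin.castAdd h a') 1 +
      ∑ c' ∈ W, Finsupp.single (Fin.natAdd h c') 1 : Fin (h + h) →₀ ℕ) : Fin (h + h) → ℕ)
      (Fin.natAdd h c) = if c ∈ W then 1 else 0 := by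
  rw [Finsupp.add_apply, Finsupp.finsetSum_apply, Finsupp.finsetSum_apply]
  simp only [Finsupp.single_apply, Fin.natAdd_inj, castAdd_ne_natAdd, if_false,
    Finset.sum_const_zero, zero_add]
  rw [Finset.sum_ite_eq' W c]

/-- `Bool.toNat b = [P]` iff `b = decide P`. -/
theorem toNat_eq_ite_iff (b : Bool) (P : Prop) [Decidable P] :
    (b.toNat = if P then 1 else 0) ↔ b = decide P := by
  cases b <;> by_cases hP : P <;> simp [hP]

/-- The monomial of a bit pattern `g` is `x^U y^W` exactly for the pattern
`a ↦ ([a ∈ U], [π a ∈ W])`. -/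
theorem patternExpo_eq_partitionExpo_iff (π : Equiv.Perm (Fin h)) (g : Fin h → Bool × Bool)
    (U W : Finset (Fin h)) :
    (∑ a', (Finsupp.single (Fin.castAdd h a') (g a').1.toNat +
      Finsupp.single (Fin.natAdd h (π a')) (g a').2.toNat)) =
      (∑ a' ∈ U, Finsupp.single (Fin.castAdd h a') 1 + ∑ c ∈ W, Finsupp.single (Fin.natAdd h c) 1)
    ↔ g = fun a => (decide (a ∈ U), decide (π a ∈ W)) := by
  constructor
  · intro hg
    funext a
    have h1 := congrArg (fun v => v (Fin.castAdd h a)) hg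
    have h2 := congrArg (fun v => v (Fin.natAdd h (π a))) hg
    simp only [patternExpo_apply_castAdd, partitionExpo_apply_castAdd, patternExpo_apply_natAdd,
      partitionExpo_apply_natAdd, Equiv.symm_apply_apply] at h1 h2
    rw [toNat_eq_ite_iff] at h1 h2
    exact Prod.ext h1 h2
  · rintro rfl
    ext x
    refine Fin.addCases (fun a => ?_) (fun c => ?_) x
    · rw [patternExpo_apply_castAdd, partitionExpo_apply_castAdd]
      by_cases ha : a ∈ U <;> simp [ha]
    · rw [patternExpo_apply_natAdd, partitionExpo_apply_natAdd]
      by_cases hc : c ∈ W <;> simp [hc]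

/-! ## 2. Coefficients of product states and of their sums -/

/-- A site polynomial `q_a` as a sum of four monomials. -/
theorem site_eq_sum_monomial (T : ℂ) (π : Equiv.Perm (Fin h)) (φ : Fin h → Bool → Bool → ℕ)
    (a : Fin h) :
    (∑ p : Bool × Bool, C (T ^ φ a p.1 p.2) * X (Fin.castAdd h a) ^ p.1.toNat *
        X (Fin.natAdd h (π a)) ^ p.2.toNat : MvPolynomial (Fin (h + h)) ℂ) =
      ∑ p : Bool × Bool, monomial (Finsupp.single (Fin.castAdd h a) p.1.toNat +
        Finsupp.single (Fin.natAdd h (π a)) p.2.toNat) (T ^ φ a p.1 p.2) := by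
  refine Finset.sum_congr rfl fun p _ => ?_
  rw [X_pow_eq_monomial, X_pow_eq_monomial, C_mul_monomial, monomial_mul, mul_one, mul_one]

/-- A product state expanded: one monomial per bit pattern `g : Fin h → Bool × Bool`. -/
theorem prodState_eq_sum_monomial (T : ℂ) (π : Equiv.Perm (Fin h))
    (φ : Fin h → Bool → Bool → ℕ) :
    (∏ a, ∑ p : Bool × Bool, C (T ^ φ a p.1 p.2) * X (Fin.castAdd h a) ^ p.1.toNat *
        X (Fin.natAdd h (π a)) ^ p.2.toNat : MvPolynomial (Fin (h + h)) ℂ) =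
      ∑ g : Fin h → Bool × Bool, monomial
        (∑ a, (Finsupp.single (Fin.castAdd h a) (g a).1.toNat +
          Finsupp.single (Fin.natAdd h (π a)) (g a).2.toNat))
        (∏ a, T ^ φ a (g a).1 (g a).2) := by
  simp_rw [site_eq_sum_monomial]
  rw [Fintype.prod_sum]
  refine Finset.sum_congr rfl fun g _ => ?_
  rw [monomial_sum_prod]

/-- **Coefficient of a product state**: `coeff_{x^U y^W} (∏_a q_a) = T ^ (Σ_a φ a [a ∈ U] [π a ∈ W])`. -/
theorem coeff_prodState (T : ℂ) (π : Equiv.Perm (Fin h)) (φ : Fin h → Bool → Bool → ℕ)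
    (U W : Finset (Fin h)) :
    coeff (∑ a ∈ U, Finsupp.single (Fin.castAdd h a) 1 + ∑ c ∈ W, Finsupp.single (Fin.natAdd h c) 1)
      (∏ a, ∑ p : Bool × Bool, C (T ^ φ a p.1 p.2) * X (Fin.castAdd h a) ^ p.1.toNat *
        X (Fin.natAdd h (π a)) ^ p.2.toNat : MvPolynomial (Fin (h + h)) ℂ) =
      T ^ ∑ a, φ a (decide (a ∈ U)) (decide (π a ∈ W)) := by
  rw [prodState_eq_sum_monomial, coeff_sum]
  simp_rw [coeff_monomial]
  rw [Finset.sum_eq_single (fun a => (decide (a ∈ U), decide (π a ∈ W)))]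
  · rw [if_pos ((patternExpo_eq_partitionExpo_iff π _ U W).mpr rfl), Finset.prod_pow_eq_pow_sum]
  · intro g _ hg
    rw [if_neg]
    rwa [patternExpo_eq_partitionExpo_iff]
  · intro hn; exact absurd (mem_univ _) hn

/-- **Coefficient of a sum of product states**: `coeff_{x^U y^W} (Σ_k ∏_a q^{(k)}_a) = Σ_k T^{score_k}`. -/
theorem coeff_sumProdStates (T : ℂ) {m : ℕ} (π : Fin m → Equiv.Perm (Fin h))
    (φ : Fin m → Fin h → Bool → Bool → ℕ) (U W : Finset (Fin h)) :
    coeff (∑ a ∈ U, Finsupp.single (Fin.castAdd h a) 1 + ∑ c ∈ W, Finsupp.single (Fin.natAdd h c) 1)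
      (∑ k, ∏ a, ∑ p : Bool × Bool, C (T ^ φ k a p.1 p.2) * X (Fin.castAdd h a) ^ p.1.toNat *
        X (Fin.natAdd h (π k a)) ^ p.2.toNat : MvPolynomial (Fin (h + h)) ℂ) =
      ∑ k, T ^ ∑ a, φ k a (decide (a ∈ U)) (decide (π k a ∈ W)) := by
  rw [coeff_sum]
  exact Finset.sum_congr rfl fun k _ => coeff_prodState T (π k) (φ k) U W

/-! ## 3. Degree and size -/

open Literature.Barriers.ValiantsHypothesis Literature.Computability.AlgebraicComplexity

/-- A site polynomial has degree `≤ 2`. -/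
theorem totalDegree_site_le (T : ℂ) (π : Equiv.Perm (Fin h)) (φ : Fin h → Bool → Bool → ℕ)
    (a : Fin h) :
    (∑ p : Bool × Bool, C (T ^ φ a p.1 p.2) * X (Fin.castAdd h a) ^ p.1.toNat *
        X (Fin.natAdd h (π a)) ^ p.2.toNat : MvPolynomial (Fin (h + h)) ℂ).totalDegree ≤ 2 := by
  refine (totalDegree_finsetSum _ _).trans (Finset.sup_le fun p _ => ?_)
  calc (C (T ^ φ a p.1 p.2) * X (Fin.castAdd h a) ^ p.1.toNat *
          X (Fin.natAdd h (π a)) ^ p.2.toNat).totalDegree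
      ≤ (C (T ^ φ a p.1 p.2) * X (Fin.castAdd h a) ^ p.1.toNat).totalDegree +
          (X (Fin.natAdd h (π a)) ^ p.2.toNat : MvPolynomial (Fin (h + h)) ℂ).totalDegree :=
        totalDegree_mul _ _
    _ ≤ ((C (T ^ φ a p.1 p.2) : MvPolynomial (Fin (h + h)) ℂ).totalDegree +
          (X (Fin.castAdd h a) ^ p.1.toNat : MvPolynomial (Fin (h + h)) ℂ).totalDegree) +
          (X (Fin.natAdd h (π a)) ^ p.2.toNat : MvPolynomial (Fin (h + h)) ℂ).totalDegree := by
        gcongr; exact totalDegree_mul _ _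
    _ ≤ (0 + p.1.toNat) + p.2.toNat := by
        gcongr
        · exact (totalDegree_C _).le
        · exact (totalDegree_pow _ _).trans (by rw [totalDegree_X]; simp)
        · exact (totalDegree_pow _ _).trans (by rw [totalDegree_X]; simp)
    _ ≤ (0 + 1) + 1 := by gcongr <;> exact Bool.toNat_le _
    _ = 2 := by norm_num

/-- A product state has degree `≤ 2h`. -/
theorem totalDegree_prodState_le (T : ℂ) (π : Equiv.Perm (Fin h))
    (φ : Fin h → Bool → Bool → ℕ) :
    (∏ a, ∑ p : Bool × Bool, C (T ^ φ a p.1 p.2) * X (Fin.castAdd h a) ^ p.1.toNat *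
        X (Fin.natAdd h (π a)) ^ p.2.toNat : MvPolynomial (Fin (h + h)) ℂ).totalDegree ≤ h + h := by
  calc (∏ a, ∑ p : Bool × Bool, C (T ^ φ a p.1 p.2) * X (Fin.castAdd h a) ^ p.1.toNat *
          X (Fin.natAdd h (π a)) ^ p.2.toNat : MvPolynomial (Fin (h + h)) ℂ).totalDegree
      ≤ ∑ a, (∑ p : Bool × Bool, C (T ^ φ a p.1 p.2) * X (Fin.castAdd h a) ^ p.1.toNat *
          X (Fin.natAdd h (π a)) ^ p.2.toNat : MvPolynomial (Fin (h + h)) ℂ).totalDegree :=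
        totalDegree_finsetProd _ _
    _ ≤ ∑ _a : Fin h, 2 := Finset.sum_le_sum fun a _ => totalDegree_site_le T π φ a
    _ = h + h := by simp; ring

/-- A sum of product states has degree `≤ 2h`. -/
theorem totalDegree_sumProdStates_le (T : ℂ) {m : ℕ} (π : Fin m → Equiv.Perm (Fin h))
    (φ : Fin m → Fin h → Bool → Bool → ℕ) :
    (∑ k, ∏ a, ∑ p : Bool × Bool, C (T ^ φ k a p.1 p.2) * X (Fin.castAdd h a) ^ p.1.toNat *
        X (Fin.natAdd h (π k a)) ^ p.2.toNat : MvPolynomial (Fin (h + h)) ℂ).totalDegree ≤ h + h :=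
  (totalDegree_finsetSum _ _).trans (Finset.sup_le fun k _ => totalDegree_prodState_le T (π k) (φ k))

/-- `X^0 = 1` and `X^1 = X` are free. -/
theorem complexity_X_pow_toNat (s : Fin (h + h)) (b : Bool) :
    complexity (X s ^ b.toNat : MvPolynomial (Fin (h + h)) ℂ) = 0 := by
  cases b
  · rw [Bool.toNat_false, pow_zero, ← C_1]
    exact complexity_C_holds _
  · rw [Bool.toNat_true, pow_one]
    exact complexity_X_holds _

/-- A site polynomial has size `≤ 12`. -/
theorem complexity_site_le (T : ℂ) (π : Equiv.Perm (Fin h)) (φ : Fin h → Bool → Bool → ℕ)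
    (a : Fin h) :
    complexity (∑ p : Bool × Bool, C (T ^ φ a p.1 p.2) * X (Fin.castAdd h a) ^ p.1.toNat *
        X (Fin.natAdd h (π a)) ^ p.2.toNat : MvPolynomial (Fin (h + h)) ℂ) ≤ 12 := by
  have hsum : ∀ p : Bool × Bool, complexity (C (T ^ φ a p.1 p.2) * X (Fin.castAdd h a) ^ p.1.toNat *
      X (Fin.natAdd h (π a)) ^ p.2.toNat : MvPolynomial (Fin (h + h)) ℂ) ≤ 2 := by
    intro p
    calc complexity (C (T ^ φ a p.1 p.2) * X (Fin.castAdd h a) ^ p.1.toNat *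
            X (Fin.natAdd h (π a)) ^ p.2.toNat : MvPolynomial (Fin (h + h)) ℂ)
        ≤ complexity (C (T ^ φ a p.1 p.2) * X (Fin.castAdd h a) ^ p.1.toNat :
              MvPolynomial (Fin (h + h)) ℂ) +
            complexity (X (Fin.natAdd h (π a)) ^ p.2.toNat : MvPolynomial (Fin (h + h)) ℂ) + 1 :=
          complexity_mul_le_holds _ _
      _ ≤ (complexity (C (T ^ φ a p.1 p.2) : MvPolynomial (Fin (h + h)) ℂ) +
            complexity (X (Fin.castAdd h a) ^ p.1.toNat : MvPolynomial (Fin (h + h)) ℂ) + 1) +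
            complexity (X (Fin.natAdd h (π a)) ^ p.2.toNat : MvPolynomial (Fin (h + h)) ℂ) + 1 := by
          gcongr; exact complexity_mul_le_holds _ _
      _ = 2 := by
          rw [complexity_C_holds, complexity_X_pow_toNat, complexity_X_pow_toNat]
  calc complexity (∑ p : Bool × Bool, C (T ^ φ a p.1 p.2) * X (Fin.castAdd h a) ^ p.1.toNat *
          X (Fin.natAdd h (π a)) ^ p.2.toNat)
      ≤ ∑ p : Bool × Bool, complexity (C (T ^ φ a p.1 p.2) * X (Fin.castAdd h a) ^ p.1.toNat *
          X (Fin.natAdd h (π a)) ^ p.2.toNat : MvPolynomial (Fin (h + h)) ℂ) +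
          (univ : Finset (Bool × Bool)).card := complexity_finset_sum_le _ _
    _ ≤ ∑ _p : Bool × Bool, 2 + (univ : Finset (Bool × Bool)).card := by
        gcongr with p _; exact hsum p
    _ = 12 := by simp

/-- A product state has size `≤ 13h`. -/
theorem complexity_prodState_le (T : ℂ) (π : Equiv.Perm (Fin h)) (φ : Fin h → Bool → Bool → ℕ) :
    complexity (∏ a, ∑ p : Bool × Bool, C (T ^ φ a p.1 p.2) * X (Fin.castAdd h a) ^ p.1.toNat *
        X (Fin.natAdd h (π a)) ^ p.2.toNat : MvPolynomial (Fin (h + h)) ℂ) ≤ 13 * h := by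
  calc complexity (∏ a, ∑ p : Bool × Bool, C (T ^ φ a p.1 p.2) * X (Fin.castAdd h a) ^ p.1.toNat *
          X (Fin.natAdd h (π a)) ^ p.2.toNat : MvPolynomial (Fin (h + h)) ℂ)
      ≤ ∑ a, complexity (∑ p : Bool × Bool, C (T ^ φ a p.1 p.2) * X (Fin.castAdd h a) ^ p.1.toNat *
          X (Fin.natAdd h (π a)) ^ p.2.toNat : MvPolynomial (Fin (h + h)) ℂ) +
          (univ : Finset (Fin h)).card := complexity_finset_prod_le _ _
    _ ≤ ∑ _a : Fin h, 12 + (univ : Finset (Fin h)).card := by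
        gcongr with a _; exact complexity_site_le T π φ a
    _ = 13 * h := by simp; ring

/-- A sum of `m` product states has size `≤ 13·h·m + m`. -/
theorem complexity_sumProdStates_le (T : ℂ) {m : ℕ} (π : Fin m → Equiv.Perm (Fin h))
    (φ : Fin m → Fin h → Bool → Bool → ℕ) :
    complexity (∑ k, ∏ a, ∑ p : Bool × Bool, C (T ^ φ k a p.1 p.2) * X (Fin.castAdd h a) ^ p.1.toNat *
        X (Fin.natAdd h (π k a)) ^ p.2.toNat : MvPolynomial (Fin (h + h)) ℂ) ≤ 13 * h * m + m := by
  calc complexity (∑ k, ∏ a, ∑ p : Bool × Bool, C (T ^ φ k a p.1 p.2) *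
          X (Fin.castAdd h a) ^ p.1.toNat * X (Fin.natAdd h (π k a)) ^ p.2.toNat :
          MvPolynomial (Fin (h + h)) ℂ)
      ≤ ∑ k, complexity (∏ a, ∑ p : Bool × Bool, C (T ^ φ k a p.1 p.2) *
          X (Fin.castAdd h a) ^ p.1.toNat * X (Fin.natAdd h (π k a)) ^ p.2.toNat :
          MvPolynomial (Fin (h + h)) ℂ) + (univ : Finset (Fin m)).card :=
        complexity_finset_sum_le _ _
    _ ≤ ∑ _k : Fin m, 13 * h + (univ : Finset (Fin m)).card := by
        gcongr with k _; exact complexity_prodState_le T (π k) (φ k)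
    _ = 13 * h * m + m := by simp; ring

/-- **Membership**: with `m ≤ (h+h)^c` terms and `h ≥ 4`, a sum of `m` product states lies in
`SmallCircuits ℂ (h+h) (c+2)`. -/
theorem sumProdStates_mem_smallCircuits (T : ℂ) {m c : ℕ} (hh : 4 ≤ h) (hm : m ≤ (h + h) ^ c)
    (π : Fin m → Equiv.Perm (Fin h)) (φ : Fin m → Fin h → Bool → Bool → ℕ) :
    (∑ k, ∏ a, ∑ p : Bool × Bool, C (T ^ φ k a p.1 p.2) * X (Fin.castAdd h a) ^ p.1.toNat *
        X (Fin.natAdd h (π k a)) ^ p.2.toNat : MvPolynomial (Fin (h + h)) ℂ) ∈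
      SmallCircuits ℂ (h + h) (c + 2) := by
  refine ⟨totalDegree_sumProdStates_le T π φ, (complexity_sumProdStates_le T π φ).trans ?_⟩
  calc 13 * h * m + m ≤ 14 * h * m := by nlinarith
    _ ≤ 14 * h * (h + h) ^ c := by gcongr
    _ ≤ (h + h) ^ 2 * (h + h) ^ c := by gcongr; nlinarith
    _ = (h + h) ^ (c + 2) := by ring

end

end Summit.ValiantsHypothesis.ValiantsHypothesis.Theorems.BarrierLever.ProductStateSums
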